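import Summits.RiemannHypothesis.RiemannHypothesis.Theses.RuelleBand
import Summits.RiemannHypothesis.RiemannHypothesis.Theorems.RuelleBandExactFirstBandStubEvenSymTranslate
import Summits.RiemannHypothesis.RiemannHypothesis.Theorems.RuelleBandExactFirstBandStubEvenExpSum
import Summits.RiemannHypothesis.RiemannHypothesis.Theorems.RuelleBandExactFirstBandStubEvenEngine
import Summits.RiemannHypothesis.RiemannHypothesis.Theorems.RuelleBandExactFirstBandStubEvenTestExists
import Summits.RiemannHypothesis.RiemannHypothesis.Theorems.RuelleBandExactFirstBandStubEvenTransfer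
import HarnessLib.Audit

/-!
# Line `SketchIdeator1` (even Weil sector): Weil positivity on symmetric pairs of bumps forces X

Crux `Summit.RiemannHypothesis.RiemannHypothesis.Theses.RuelleBand.ExactFirstBand`
(item stmt-RiemannHypothesis-2061), line `SketchIdeator1`, stub `stub_evenBumpCriterion`.

The line's even-sector Weil criterion (`stub_evenTransfer`, file `…StubEvenTransfer.lean`) derives
X (= every zero `s` of `ζ` with `0 < Re s < 1` has `Re s = 1/2` or `Im s = 0`) from Weil positivity
`0 ≤ Re W(g ⋆ g̃)` on ALL even real-valued test functions `g`.  Inspection of that proof shows that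
positivity is only ever USED on the symmetric translates `h_x(t) = (g(t - x) + g(t + x))/2` of ONE
narrow even real bump `g = b` (a Mathlib `ContDiffBump (0 : ℝ)`, coerced to `ℂ`).  This file records
the sharper statement with that PINNED test class:

  `(∀ b : ContDiffBump 0, ∀ x, 0 ≤ Re W(h ⋆ h̃), h = (b(· - x) + b(· + x))/2) ⟹ X`.

## Proof

Let `s` be a zero with `0 < Re s < 1` (a non-trivial zero, `mem_iff'`) and suppose `Re s ≠ 1/2`.
Take the bump `b` of radii `δ/2 < δ`, `δ = 1/(1 + |Im s|)`: on its support `cos (Im s · t) ≥ 0`, so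
`Re ĝ(σ + i Im s) > 0` for every real `σ` (`exists_bump_re_weilMellin_pos`, the construction of
`exists_even_real_isWeilTest_re_weilMellin_pos` with the bump exposed), in particular `ĝ(s) ≠ 0` for
`g = b`.  The function `g` is an even (`ContDiffBump.neg`) real-valued test function.  For every
real `x`, `h = h_{x/2}` is LITERALLY the symmetric pair of bumps of the hypothesis, so
`0 ≤ Re W(h ⋆ h̃) = Re Q₀(h) = (Re B_g(x) + Re Q₀(g))/2` (`Q₀(h) = W(h ⋆ h̃)` by
`WeilConverse.hasWeilZeroSide_zeroForm` and the PROVED explicit formula `explicit_formula_holds`;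
the second identity is `stub_evenSymTranslate`), i.e. the one-sided bound `Re B_g(x) ≥ -Re Q₀(g)`
(`bump_lowerBound`).  With `B_g` real (`stub_evenExpSum`) the ENGINE `stub_evenEngine` gives,
through the per-function bookkeeping `stub_evenTransfer_weilMellin_eq_zero` of the transfer file,
`ĝ(s) = 0`: contradiction.

References: E. Bombieri, *Remarks on Weil's quadratic functional in the theory of prime numbers I*,
Rend. Lincei (9) 11 (2000), 183–233, §3 Thm. 1; A. Weil, *Sur les "formules explicites" de la
théorie des nombres premiers* (1952).
-/

-- the problem directory `RiemannHypothesis/RiemannHypothesis` fixes the namespace (gate convention)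
set_option linter.dupNamespace false

noncomputable section

open Complex MeasureTheory Filter Set
open scoped Real Topology ComplexConjugate

namespace Summit.RiemannHypothesis.RiemannHypothesis.Theorems.RuelleBandExactFirstBand

open Literature.NumberTheory.LFunctions

/-- A bump function, coerced to `ℂ`, is a Weil test function (smooth: `ContDiffBump.contDiff`;
compactly supported: `ContDiffBump.hasCompactSupport`). [folklore] -/
theorem isWeilTest_bump (b : ContDiffBump (0 : ℝ)) : IsWeilTest fun t : ℝ => ((b t : ℝ) : ℂ) :=
  ⟨Complex.ofRealCLM.contDiff.comp b.contDiff, b.hasCompactSupport.comp_left Complex.ofReal_zero⟩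

/-- A bump function centred at `0` is even (`ContDiffBump.neg`). [folklore] -/
theorem bump_even (b : ContDiffBump (0 : ℝ)) (t : ℝ) :
    (fun t : ℝ => ((b t : ℝ) : ℂ)) (-t) = (fun t : ℝ => ((b t : ℝ) : ℂ)) t := by
  simp only [b.neg]

/-- A bump function, coerced to `ℂ`, is real-valued. [folklore] -/
theorem bump_real (b : ContDiffBump (0 : ℝ)) (t : ℝ) :
    ((fun t : ℝ => ((b t : ℝ) : ℂ)) t).im = 0 :=
  Complex.ofReal_im _

/-- For every ordinate `γ` there is a **bump** `b` at `0` with `Re b̂(σ + iγ) > 0` for every real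
`σ`: take radii `δ/2 < δ` with `δ = 1/(1 + |γ|)`; on the support `|t| < δ` one has `cos(γ t) ≥ 0`,
with positivity at `t = 0`, and `Re (b(t) e^{(σ + iγ - 1/2)t}) = b(t) e^{(σ-1/2)t} cos(γ t)`.  (The
construction of `exists_even_real_isWeilTest_re_weilMellin_pos`, with the bump exposed.)
[folklore] -/
theorem exists_bump_re_weilMellin_pos (γ : ℝ) :
    ∃ b : ContDiffBump (0 : ℝ),
      ∀ σ : ℝ, 0 < (weilMellin (fun t : ℝ => ((b t : ℝ) : ℂ)) (σ + γ * I)).re := by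
  -- adapted from `exists_even_real_isWeilTest_re_weilMellin_pos` (…StubEvenTestExists.lean) and
  -- Literature/NumberTheory/LFunctions/WeilMellinBounds.lean
  -- (`exists_isWeilTest_re_weilMellin_pos`)
  set δ : ℝ := 1 / (1 + |γ|) with hδ
  have hδpos : 0 < δ := by positivity
  let b : ContDiffBump (0 : ℝ) := ⟨δ / 2, δ, by positivity, by linarith⟩
  refine ⟨b, fun σ ↦ ?_⟩
  -- the integrand has real part `b(t) e^{(σ-1/2)t} cos(γ t) ≥ 0`, positive at `t = 0`
  set F : ℝ → ℝ := fun t ↦ b t * Real.exp ((σ - 1 / 2) * t) * Real.cos (γ * t) with hF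
  have hint : Integrable fun t : ℝ ↦ ((b t : ℝ) : ℂ) * cexp ((σ + γ * I - 1 / 2) * t) :=
    integrable_weilIntegrand (Complex.continuous_ofReal.comp b.continuous)
      (b.hasCompactSupport.comp_left Complex.ofReal_zero) _
  have hre : ∀ t : ℝ, (((b t : ℝ) : ℂ) * cexp ((σ + γ * I - 1 / 2) * t)).re = F t := by
    intro t
    rw [Complex.re_ofReal_mul, Complex.exp_re]
    have h1 : ((σ + γ * I - 1 / 2) * (t : ℂ)).re = (σ - 1 / 2) * t := by
      simp [sub_re, add_re, mul_re]
    have h2 : ((σ + γ * I - 1 / 2) * (t : ℂ)).im = γ * t := by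
      simp [sub_im, add_im, mul_im]
    rw [h1, h2, hF]
    ring
  unfold weilMellin
  have hI := integral_re hint
  simp only [RCLike.re_to_complex] at hI
  beta_reduce
  rw [← hI]
  simp_rw [hre]
  have hFc : Continuous F := by
    simp only [hF]
    have hb := b.continuous
    fun_prop
  have hFsupp : HasCompactSupport F := by
    simp only [hF]
    exact (b.hasCompactSupport.mul_right).mul_right
  have hFnn : 0 ≤ F := by
    intro t
    simp only [hF, Pi.zero_apply]
    by_cases ht : |t| < δ
    · refine mul_nonneg (mul_nonneg (b.nonneg' t) (Real.exp_pos _).le)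
        (Real.cos_nonneg_of_mem_Icc ?_)
      have hγt : |γ * t| ≤ 1 := by
        rw [abs_mul]
        calc |γ| * |t| ≤ |γ| * δ := mul_le_mul_of_nonneg_left ht.le (abs_nonneg _)
          _ = |γ| / (1 + |γ|) := by rw [hδ]; ring
          _ ≤ 1 := by rw [div_le_one (by positivity)]; linarith
      constructor <;> nlinarith [abs_le.1 hγt, Real.pi_gt_three]
    · have hb : b t = 0 := b.zero_of_le_dist (by simpa [Real.dist_eq] using not_lt.1 ht)
      simp [hb]
  have hF0 : F 0 ≠ 0 := by
    have hb0 : b 0 = 1 := b.one_of_mem_closedBall (by simp [b]; positivity)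
    simp [hF, hb0]
  exact hFc.integral_pos_of_hasCompactSupport_nonneg_nonzero hFsupp hFnn hF0

/-- **The one-sided bound from positivity on symmetric pairs of bumps.**  If `0 ≤ Re W(h ⋆ h̃)` for
every symmetric pair `h = (b(· - x) + b(· + x))/2` of bumps, then for every bump `b`, with `g = b`
(coerced to `ℂ`) and every real `x`: `-Re Q₀(g) ≤ Re B_g(x)`.  Indeed `h = h_{x/2}` is such a pair,
and `Re W(h ⋆ h̃) = Re Q₀(h) = (Re B_g(x) + Re Q₀(g))/2`, where `Q₀(h) = W(h ⋆ h̃)` because both are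
the limit of the symmetric partial zero sums of `h ⋆ h̃` (`WeilConverse.hasWeilZeroSide_zeroForm`
and the PROVED explicit formula `explicit_formula_holds`), and the second identity is
`zeroForm_symTranslate` (`stub_evenSymTranslate`). [folklore] -/
theorem bump_lowerBound
    (hB : ∀ (b : ContDiffBump (0 : ℝ)) (x : ℝ),
      0 ≤ (weilQuadratic (fun t : ℝ => (((b (t - x) : ℝ) : ℂ) + ((b (t + x) : ℝ) : ℂ)) / 2)).re)
    (b : ContDiffBump (0 : ℝ)) (x : ℝ) :
    -(WeilConverse.zeroForm (fun t : ℝ => ((b t : ℝ) : ℂ))).re ≤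
      (WeilConverse.expSum (fun t : ℝ => ((b t : ℝ) : ℂ)) x).re := by
  -- adapted from `stub_evenTransfer_lowerBound` (…StubEvenTransfer.lean)
  have hg : IsWeilTest fun t : ℝ => ((b t : ℝ) : ℂ) := isWeilTest_bump b
  have hh : IsWeilTest fun t : ℝ => (((b (t - x / 2) : ℝ) : ℂ) + ((b (t + x / 2) : ℝ) : ℂ)) / 2 :=
    isWeilTest_symTranslate hg (x / 2)
  have hQ : WeilConverse.zeroForm
      (fun t : ℝ => (((b (t - x / 2) : ℝ) : ℂ) + ((b (t + x / 2) : ℝ) : ℂ)) / 2) =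
      ((((WeilConverse.expSum (fun t : ℝ => ((b t : ℝ) : ℂ)) (2 * (x / 2))).re : ℝ) : ℂ) +
        WeilConverse.zeroForm (fun t : ℝ => ((b t : ℝ) : ℂ))) / 2 :=
    zeroForm_symTranslate hg (x / 2)
  have h0 := hB b (x / 2)
  -- `Q₀(h) = W(h ⋆ h̃)`
  have hQW : WeilConverse.zeroForm
      (fun t : ℝ => (((b (t - x / 2) : ℝ) : ℂ) + ((b (t + x / 2) : ℝ) : ℂ)) / 2) =
      weilQuadratic (fun t : ℝ => (((b (t - x / 2) : ℝ) : ℂ) + ((b (t + x / 2) : ℝ) : ℂ)) / 2) :=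
    tendsto_nhds_unique (WeilConverse.hasWeilZeroSide_zeroForm hh)
      (explicit_formula_holds (hh.weilConv hh.weilReflect))
  rw [← hQW, hQ, show 2 * (x / 2) = x by ring, Complex.div_ofNat_re, Complex.add_re,
    Complex.ofReal_re] at h0
  linarith

/-- **Stub `stub_evenBumpCriterion` of line `SketchIdeator1` (registered signature): Weil positivity
on symmetric pairs of bumps already forces X.**  Given a zero `s` of `ζ` with `0 < Re s < 1` (a
non-trivial zero, `mem_iff'`) and `Re s ≠ 1/2`, the bump `b` of
`exists_bump_re_weilMellin_pos (Im s)` has `b̂(s) ≠ 0` (`s = Re s + i Im s`); but `g = b` is an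
even real test function with `B_g` real (`stub_evenExpSum`) and `Re B_g ≥ -Re Q₀(g)`
(`bump_lowerBound`, from the hypothesis), so the ENGINE (`stub_evenEngine`) through
`stub_evenTransfer_weilMellin_eq_zero` gives `b̂(s) = 0`. -/
theorem stub_evenBumpCriterion :
    (∀ (b : ContDiffBump (0 : ℝ)) (x : ℝ),
      0 ≤ (weilQuadratic (fun t : ℝ => (((b (t - x) : ℝ) : ℂ) + ((b (t + x) : ℝ) : ℂ)) / 2)).re) →
    ∀ s : ℂ, riemannZeta s = 0 → 0 < s.re → s.re < 1 → s.re = 1 / 2 ∨ s.im = 0 := by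
  intro hB s hs h0 h1
  have hmem : s ∈ ZetaZeros.riemannZetaNontrivialZeros :=
    ZetaZeros.riemannZetaNontrivialZeros.mem_iff'.2 ⟨hs, h0, h1⟩
  refine Or.inl ?_
  by_contra hne
  obtain ⟨b, hpos⟩ := exists_bump_re_weilMellin_pos s.im
  have hg : IsWeilTest fun t : ℝ => ((b t : ℝ) : ℂ) := isWeilTest_bump b
  have hz : weilMellin (fun t : ℝ => ((b t : ℝ) : ℂ)) s = 0 :=
    stub_evenTransfer_weilMellin_eq_zero stub_evenEngine hg (bump_even b) (bump_real b)
      (fun x ↦ ((stub_evenExpSum _ hg (bump_even b)).2 x).2) (bump_lowerBound hB b) hmem hne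
  have h2 := hpos s.re
  rw [Complex.re_add_im, hz, Complex.zero_re] at h2
  exact lt_irrefl 0 h2

end Summit.RiemannHypothesis.RiemannHypothesis.Theorems.RuelleBandExactFirstBand

end
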